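/-
Copyright (c) 2026. All rights reserved.
Released under Apache 2.0 license as described in the file LICENSE.
Authors: abc-iut cell — seat abc-iut-f-063 (block F fact-proving wave, tranche 63: FACT-LIST rows F-0227
`CompatibleWithCombinatorialQuotients`, F-0228 `DualGraphData.TrivialAction`, F-0229 `InducesGraphIso`).
-/
import Mathlib.Topology.Instances.ZMod
import Literature.AnabelianGeometry.AbsoluteAnabelian.AbsTopIGraphTheoreticity
import Literature.AnabelianGeometry.AbsoluteAnabelian.AbsTopIGraphCuspidalNonVacuity
import HarnessLib

/-!
# [AbsTopI] Thm 2.14 — the three typed predicates as SCHEMATA: structural instance forms, universal closures refuted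

S. Mochizuki, *Topics in Absolute Anabelian Geometry I: Generalities* [MochizukiAbsTopI2012], Thm 2.14 p. 33:
(i) an isomorphism `φ : Π₁ ≅ Π₂` "induces an isomorphism of semi-graphs `φ_Γ : Γ₁ ≅ Γ₂`" compatible with the
Galois actions; (ii) when the Galois actions on the dual semi-graphs `Γᵢ` are trivial, "`φ` is compatible with
the quotients `Πᵢ ↠ Δᵢ^{com}`".  The trunk file `AbsTopIGraphTheoreticity.lean` types the graph part of (i), the
hypothesis of (ii) and the conclusion of (ii) as PREDICATES on declared data — `InducesGraphIso Γ₁ Γ₂ φ hφ`,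
`DualGraphData.TrivialAction Γ`, `CompatibleWithCombinatorialQuotients Q₁ Q₂ φ` — over abstract dual-graph data
`Γᵢ : DualGraphData` and abstract combinatorial quotients `Qᵢ : CombinatorialQuotient` (the cell's frozen
FACT-LIST rows F-0229, F-0228, F-0227, all of kernel-closedness `parametrised`).

This PROOF-ONLY companion (no `def` / `instance` / `structure`; it imports, never edits, the trunk file) records
what the kernel can say about the three predicates as SCHEMATA:

* STRUCTURAL INSTANCE FORMS (hold for all data): `preservesGeom_refl`, `PreservesGeom.galEquiv_refl_apply`,
  `inducesGraphIso_refl` — (i) holds for `φ = id` on any dual-graph data; `InducesGraphIso.nonempty_vertex_equiv`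
  / `nonempty_edge_equiv` — (i) forces equinumerous vertices and edges; `compatibleWithCombinatorialQuotients_refl`
  / `.symm` / `.trans` — (ii)'s conclusion is an equivalence relation along `refl` / `symm` / `trans`;
  `compatibleWithCombinatorialQuotients_iff_exists_mulEquiv` — the typed kernel condition
  `φ(Ker(Π₁ ↠ Δ₁^{com})) = Ker(Π₂ ↠ Δ₂^{com})` is EQUIVALENT to the printed reading "`φ` induces an isomorphism
  `Δ₁^{com} ≅ Δ₂^{com}` compatible with the two quotient maps"; `DualGraphData.trivialAction_of_subsingleton`.
* UNIVERSAL CLOSURES REFUTED at explicit degenerate data (each predicate types a claim about ONE genuine object —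
  the dual semi-graph of the stable model, resp. the genuine combinatorial quotient — and is consumable only in
  instance form): `exists_not_inducesGraphIso` / `not_forall_inducesGraphIso` (F-0229: cuspidal stars with `0`
  and `1` open edges over the point extension, `φ = id` — no isomorphism of semi-graphs exists, although both
  Galois actions are trivial); `DualGraphData.exists_not_trivialAction` / `not_forall_trivialAction` (F-0228: the
  regular action of `G = ℤ/2` on the edgeless semi-graph with vertex set `G`); `exists_not_compatibleWith…` /
  `not_forall_compatibleWithCombinatorialQuotients` (F-0227: `Δ^{com} = 1` versus the tautological quotient
  `Π ↠ Π` over `Π = ℤ/2`, `φ = id`).  MODEL instances where (i) and (ii) HOLD are abc-iut-w5-d053's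
  `AbsTopIGraphCuspidalNonVacuity.lean` (good-reduction model), consumed here BY NAME.

HONEST FRAMING: refuting a universal closure over abstract declared data is NOT a refutation of the printed
theorem (whose data are the genuine dual semi-graph and combinatorial quotient of a hyperbolic curve over an MLF,
not constructible without étale `π₁` — FOUNDATIONS row 12); a structural lemma is a fact about the cell's typing.
Nothing here bears on the disputed [IUTchIII] Cor. 3.12; no side taken; typed ≠ proved; a FACT row is an
assumption label, not an endorsement.
-/

namespace Literature.AnabelianGeometry.AbsoluteAnabelian

open CategoryTheory Topology
open Literature.AnabelianGeometry.SemiGraphs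

universe u

namespace FundamentalExtension

variable {E F K : FundamentalExtension.{u}}

/-! ### `PreservesGeom` and `galEquiv` along the identity -/

variable (E) in
/-- The identity `Π ≅ Π` carries `Δ` onto `Δ` ([AbsAnab] Lemma 1.3.8 predicate at `α = id`).
[cite: MochizukiAbsAnab2004, Lemma 1.3.8 p.18] -/
theorem preservesGeom_refl : PreservesGeom (ContinuousMulEquiv.refl E.arith) := by
  change E.geom.map _ = E.geom
  ext x
  constructor
  · rintro ⟨y, hy, rfl⟩
    exact hy
  · intro hx
    exact ⟨x, hx, rfl⟩

/-- The isomorphism `G ≅ G` induced by the identity of `Π` is the identity: `galEquiv (aug x) = aug x`, hence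
`galEquiv g = g` (`aug` is surjective). [cite: MochizukiAbsAnab2004, Lemma 1.3.8 p.18] -/
theorem PreservesGeom.galEquiv_refl_apply (hφ : PreservesGeom (ContinuousMulEquiv.refl E.arith)) (g : E.gal) :
    hφ.galEquiv g = g := by
  obtain ⟨x, rfl⟩ := E.aug_surjective g
  unfold PreservesGeom.galEquiv
  rw [MulEquiv.trans_apply, MulEquiv.trans_apply]
  have h1 : E.quotientGeomEquivGal.symm (E.aug x) = QuotientGroup.mk x := by
    rw [MulEquiv.symm_apply_eq]
    rfl
  rw [h1]
  rfl

/-! ### F-0229 — `InducesGraphIso` ([AbsTopI] Thm 2.14 (i) p.33): structural instance forms -/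

/-- **(i) along the identity.** For every dual-graph datum `Γ` on `E`, the identity `Π ≅ Π` "induces an
isomorphism of semi-graphs `Γ ≅ Γ` compatible with the Galois actions" — namely the identity of `Γ` (FACT-LIST
F-0229, structural instance form). [cite: MochizukiAbsTopI2012, Thm 2.14 (i) p.33] -/
theorem inducesGraphIso_refl (Γ : DualGraphData E) (hφ : PreservesGeom (ContinuousMulEquiv.refl E.arith)) :
    InducesGraphIso Γ Γ (ContinuousMulEquiv.refl E.arith) hφ := by
  refine ⟨Iso.refl _, fun g => ?_⟩
  rw [hφ.galEquiv_refl_apply g]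
  simp

/-- (i) forces the dual semi-graphs to have equinumerous VERTICES (irreducible components of the geometric special
fibres): an isomorphism of semi-graphs is a bijection on vertices (FACT-LIST F-0229, structural consequence).
[cite: MochizukiAbsTopI2012, Thm 2.14 (i) p.33] -/
theorem InducesGraphIso.nonempty_vertex_equiv {Γ₁ : DualGraphData E} {Γ₂ : DualGraphData F}
    {φ : E.arith ≃ₜ* F.arith} {hφ : PreservesGeom φ} (h : InducesGraphIso Γ₁ Γ₂ φ hφ) :
    Nonempty (Γ₁.graph.Vertex ≃ Γ₂.graph.Vertex) := by
  obtain ⟨i, -⟩ := h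
  exact ⟨{ toFun := i.hom.vertexMap, invFun := i.inv.vertexMap,
           left_inv := fun v => congrFun (congrArg SemiGraph.Hom.vertexMap i.hom_inv_id) v,
           right_inv := fun v => congrFun (congrArg SemiGraph.Hom.vertexMap i.inv_hom_id) v }⟩

/-- (i) forces the dual semi-graphs to have equinumerous EDGES (nodes and cusps of the geometric special fibres):
an isomorphism of semi-graphs is a bijection on edges (FACT-LIST F-0229, structural consequence).
[cite: MochizukiAbsTopI2012, Thm 2.14 (i) p.33] -/
theorem InducesGraphIso.nonempty_edge_equiv {Γ₁ : DualGraphData E} {Γ₂ : DualGraphData F}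
    {φ : E.arith ≃ₜ* F.arith} {hφ : PreservesGeom φ} (h : InducesGraphIso Γ₁ Γ₂ φ hφ) :
    Nonempty (Γ₁.graph.Edge ≃ Γ₂.graph.Edge) := by
  obtain ⟨i, -⟩ := h
  exact ⟨{ toFun := i.hom.edgeMap, invFun := i.inv.edgeMap,
           left_inv := fun e => congrFun (congrArg SemiGraph.Hom.edgeMap i.hom_inv_id) e,
           right_inv := fun e => congrFun (congrArg SemiGraph.Hom.edgeMap i.inv_hom_id) e }⟩

/-! ### F-0229 — the universal closure of `InducesGraphIso` is refuted -/

/-- **F-0229, universal closure REFUTED.** Over the point extension `Π = G = 1` take the good-reduction dual-graph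
data with `0` and with `1` cusp (cuspidal stars with `0` resp. `1` open edge, trivial Galois actions —
abc-iut-w5-d053's `DualGraphData.exists_cuspidalStar`) and `φ = id`: both actions are trivial, `φ` preserves
`Δ`, yet NO isomorphism of semi-graphs `Γ₁ ≅ Γ₂` exists (edge sets of cardinality `0 ≠ 1`), so
`InducesGraphIso Γ₁ Γ₂ id _` fails.  Reading: `InducesGraphIso` is a SCHEMA over abstract declared data (the
genuine datum is the dual semi-graph of THE stable model of the curve with the given `Π`); refuting its universal
closure is not a statement about print. [cite: MochizukiAbsTopI2012, Thm 2.14 (i) p.33] -/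
theorem exists_not_inducesGraphIso :
    ∃ (E : FundamentalExtension.{u}) (Γ₁ Γ₂ : DualGraphData E)
      (hφ : PreservesGeom (ContinuousMulEquiv.refl E.arith)),
      Γ₁.TrivialAction ∧ Γ₂.TrivialAction ∧ ¬ InducesGraphIso Γ₁ Γ₂ (ContinuousMulEquiv.refl E.arith) hφ := by
  let E : FundamentalExtension.{u} :=
    { arith := ProfiniteGrp.of PUnit.{u + 1}, gal := ProfiniteGrp.of PUnit.{u + 1},
      aug := ContinuousMonoidHom.id _, aug_surjective := Function.surjective_id }
  obtain ⟨G₀, -, ⟨e₀⟩, -, -⟩ := DualGraphData.exists_cuspidalStar.{u} 0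
  obtain ⟨G₁, -, ⟨e₁⟩, -, -⟩ := DualGraphData.exists_cuspidalStar.{u} 1
  refine ⟨E, ⟨G₀, 1⟩, ⟨G₁, 1⟩, preservesGeom_refl E, fun _ => rfl, fun _ => rfl, fun h => ?_⟩
  obtain ⟨e⟩ := h.nonempty_edge_equiv
  exact (e₀ (e.symm (e₁.symm 0))).elim0

/-- **F-0229 as a closed universal statement is FALSE**: it is not the case that for all extensions, all
dual-graph data, and all `Δ`-preserving `φ : Π₁ ≅ Π₂`, `φ` induces a compatible isomorphism of semi-graphs
(witness: `exists_not_inducesGraphIso`).  The row is consumable only AT NAMED INSTANCES (model instance where it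
holds: `DualGraphData.exists_goodReductionModel_inducesGraphIso`). [cite: MochizukiAbsTopI2012, Thm 2.14 (i) p.33] -/
theorem not_forall_inducesGraphIso :
    ¬ ∀ (E F : FundamentalExtension.{u}) (Γ₁ : DualGraphData E) (Γ₂ : DualGraphData F)
        (φ : E.arith ≃ₜ* F.arith) (hφ : PreservesGeom φ), InducesGraphIso Γ₁ Γ₂ φ hφ := by
  intro h
  obtain ⟨E, Γ₁, Γ₂, hφ, -, -, hnot⟩ := exists_not_inducesGraphIso.{u}
  exact hnot (h E E Γ₁ Γ₂ _ hφ)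

/-! ### F-0228 — `DualGraphData.TrivialAction` ([AbsTopI] Thm 2.14 (ii) p.33, the HYPOTHESIS of (ii)) -/

/-- `TrivialAction` says exactly that the action homomorphism `G → Aut(Γ)` is the trivial homomorphism.
[cite: MochizukiAbsTopI2012, Thm 2.14 (ii) p.33] -/
theorem DualGraphData.trivialAction_iff_galAction_eq_one (Γ : DualGraphData E) :
    Γ.TrivialAction ↔ Γ.galAction = 1 := by
  rw [MonoidHom.ext_iff]
  rfl

/-- **Instance form (degenerate base).** Over an extension with trivial `G` every dual-graph datum has trivial
Galois action (FACT-LIST F-0228 at `G = 1`). [cite: MochizukiAbsTopI2012, Thm 2.14 (ii) p.33] -/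
theorem DualGraphData.trivialAction_of_subsingleton [Subsingleton E.gal] (Γ : DualGraphData E) :
    Γ.TrivialAction :=
  fun g => by rw [Subsingleton.elim g 1, map_one]

/-- **F-0228, universal closure REFUTED.** `TrivialAction` is the HYPOTHESIS of Thm 2.14 (ii) ("when the Galois
actions on the `Γᵢ` are trivial"), not an assertion of print, and as a predicate on abstract dual-graph data it
fails somewhere: over the point extension `Π = G = ℤ/2` let `G` act on the finite EDGELESS semi-graph with vertex
set `G` (two vertices) by left translation — the non-trivial element swaps the two vertices, so the action is
not trivial.  (Genuinely non-trivial Galois actions on dual graphs occur whenever `G_k` permutes the irreducible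
components of the geometric special fibre.) [cite: MochizukiAbsTopI2012, Thm 2.14 (ii) p.33] -/
theorem DualGraphData.exists_not_trivialAction :
    ∃ (E : FundamentalExtension.{u}) (Γ : DualGraphData E),
      Γ.graph.IsFinite ∧ IsEmpty Γ.graph.Edge ∧ ¬ Γ.TrivialAction := by
  -- the two-element group `ℤ/2`, discrete, in universe `u`
  let Z : Type u := ULift.{u} (Multiplicative (ZMod 2))
  let E : FundamentalExtension.{u} :=
    { arith := ProfiniteGrp.of Z, gal := ProfiniteGrp.of Z, aug := ContinuousMonoidHom.id Z,
      aug_surjective := Function.surjective_id }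
  -- the edgeless semi-graph with vertex set `Z`
  let Γ₀ : SemiGraph.{u} :=
    { Vertex := Z, Edge := PEmpty.{u + 1}, Branch := PEmpty.{u + 1}, edgeOf := fun b => b.elim,
      abuts := fun b => b.elim, two_branches := fun e => e.elim }
  -- left translation by `g` as an endomorphism of `Γ₀`
  let τ : Z → (Γ₀ ⟶ Γ₀) := fun g =>
    { vertexMap := fun v : Z => g * v, edgeMap := id, branchMap := id,
      edgeOf_branchMap := fun b => b.elim, branchMap_injOn := fun b => b.elim,
      abuts_branchMap := fun b => b.elim }
  have hτ_mul : ∀ g h : Z, τ (g * h) = τ h ≫ τ g := fun g h =>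
    SemiGraph.hom_ext _ _ (funext fun v => mul_assoc g h v) rfl rfl
  have hτ_one : τ 1 = 𝟙 Γ₀ := SemiGraph.hom_ext _ _ (funext fun v => one_mul v) rfl rfl
  -- the regular action `Z → Aut Γ₀`
  let ι : Z → Aut Γ₀ := fun g =>
    { hom := τ g, inv := τ g⁻¹,
      hom_inv_id := by rw [← hτ_mul, inv_mul_cancel, hτ_one],
      inv_hom_id := by rw [← hτ_mul, mul_inv_cancel, hτ_one] }
  let ρ : Z →* Aut Γ₀ :=
    { toFun := ι,
      map_one' := Iso.ext hτ_one,
      map_mul' := fun g h => Iso.ext (hτ_mul g h) }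
  refine ⟨E, ⟨Γ₀, ρ⟩, ⟨inferInstanceAs (Finite Z), inferInstanceAs (Finite PEmpty.{u + 1})⟩,
    inferInstanceAs (IsEmpty PEmpty.{u + 1}), fun htriv => ?_⟩
  -- the non-trivial element moves the vertex `1`
  let g : Z := ULift.up (Multiplicative.ofAdd 1)
  have hg : g ≠ 1 := fun h => absurd (congrArg ULift.down h) (by decide)
  have h1 : ρ g = 1 := htriv g
  have h2 : (τ g).vertexMap 1 = (𝟙 Γ₀ : Γ₀ ⟶ Γ₀).vertexMap 1 :=
    congrArg (fun i : Aut Γ₀ => i.hom.vertexMap (1 : Z)) h1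
  exact hg ((mul_one g).symm.trans h2)

/-- **F-0228 as a closed universal statement is FALSE**: not every dual-graph datum over every extension has
trivial Galois action (witness: `DualGraphData.exists_not_trivialAction`).  The row is a HYPOTHESIS predicate,
consumable only at named instances (model instance where it holds: `DualGraphData.exists_goodReductionModel`).
[cite: MochizukiAbsTopI2012, Thm 2.14 (ii) p.33] -/
theorem DualGraphData.not_forall_trivialAction :
    ¬ ∀ (E : FundamentalExtension.{u}) (Γ : DualGraphData E), Γ.TrivialAction := by
  intro h
  obtain ⟨E, Γ, -, -, hnot⟩ := DualGraphData.exists_not_trivialAction.{u}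
  exact hnot (h E Γ)

/-! ### F-0227 — `CompatibleWithCombinatorialQuotients` ([AbsTopI] Thm 2.14 (ii) p.33): structural instance forms -/

/-- **(ii) along the identity**: `id : Π ≅ Π` is compatible with any quotient `Π ↠ Δ^{com}` taken twice
(FACT-LIST F-0227, structural instance form). [cite: MochizukiAbsTopI2012, Thm 2.14 (ii) p.33] -/
theorem compatibleWithCombinatorialQuotients_refl (Q : CombinatorialQuotient E) :
    CompatibleWithCombinatorialQuotients Q Q (ContinuousMulEquiv.refl E.arith) := by
  change Q.proj.toMonoidHom.ker.map _ = Q.proj.toMonoidHom.ker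
  ext x
  constructor
  · rintro ⟨y, hy, rfl⟩
    exact hy
  · intro hx
    exact ⟨x, hx, rfl⟩

/-- **(ii) is symmetric**: if `φ` carries `Ker(Π₁ ↠ Δ₁^{com})` onto `Ker(Π₂ ↠ Δ₂^{com})`, then `φ⁻¹` carries the
latter onto the former. [cite: MochizukiAbsTopI2012, Thm 2.14 (ii) p.33] -/
theorem CompatibleWithCombinatorialQuotients.symm {Q₁ : CombinatorialQuotient E} {Q₂ : CombinatorialQuotient F}
    {φ : E.arith ≃ₜ* F.arith} (h : CompatibleWithCombinatorialQuotients Q₁ Q₂ φ) :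
    CompatibleWithCombinatorialQuotients Q₂ Q₁ φ.symm := by
  change Q₁.proj.toMonoidHom.ker.map φ.toMulEquiv.toMonoidHom = Q₂.proj.toMonoidHom.ker at h
  change Q₂.proj.toMonoidHom.ker.map φ.symm.toMulEquiv.toMonoidHom = Q₁.proj.toMonoidHom.ker
  rw [← h, Subgroup.map_map]
  ext x
  constructor
  · rintro ⟨y, hy, rfl⟩
    change φ.symm (φ y) ∈ _
    rwa [ContinuousMulEquiv.symm_apply_apply]
  · intro hx
    refine ⟨x, hx, ?_⟩
    change φ.symm (φ x) = x
    rw [ContinuousMulEquiv.symm_apply_apply]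

/-- **(ii) is transitive**: compatibility along `φ : Π₁ ≅ Π₂` and along `ψ : Π₂ ≅ Π₃` gives compatibility along
`ψ ∘ φ`. [cite: MochizukiAbsTopI2012, Thm 2.14 (ii) p.33] -/
theorem CompatibleWithCombinatorialQuotients.trans {Q₁ : CombinatorialQuotient E} {Q₂ : CombinatorialQuotient F}
    {Q₃ : CombinatorialQuotient K} {φ : E.arith ≃ₜ* F.arith} {ψ : F.arith ≃ₜ* K.arith}
    (h₁₂ : CompatibleWithCombinatorialQuotients Q₁ Q₂ φ) (h₂₃ : CompatibleWithCombinatorialQuotients Q₂ Q₃ ψ) :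
    CompatibleWithCombinatorialQuotients Q₁ Q₃ (φ.trans ψ) := by
  change Q₁.proj.toMonoidHom.ker.map φ.toMulEquiv.toMonoidHom = Q₂.proj.toMonoidHom.ker at h₁₂
  change Q₂.proj.toMonoidHom.ker.map ψ.toMulEquiv.toMonoidHom = Q₃.proj.toMonoidHom.ker at h₂₃
  change Q₁.proj.toMonoidHom.ker.map (φ.trans ψ).toMulEquiv.toMonoidHom = Q₃.proj.toMonoidHom.ker
  have hcomp : (φ.trans ψ).toMulEquiv.toMonoidHom =
      ψ.toMulEquiv.toMonoidHom.comp φ.toMulEquiv.toMonoidHom := MonoidHom.ext fun _ => rfl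
  rw [hcomp, ← Subgroup.map_map, h₁₂, h₂₃]

/-- **The typed condition IS the printed reading.** `CompatibleWithCombinatorialQuotients Q₁ Q₂ φ` — "`φ` carries
`Ker(Π₁ ↠ Δ₁^{com})` onto `Ker(Π₂ ↠ Δ₂^{com})`" — holds if and only if `φ` INDUCES an isomorphism of groups
`Δ₁^{com} ≅ Δ₂^{com}` compatible with the two quotient maps ("`φ` is compatible with the quotients
`Πᵢ ↠ Δᵢ^{com}`"). [cite: MochizukiAbsTopI2012, Thm 2.14 (ii) p.33] -/
theorem compatibleWithCombinatorialQuotients_iff_exists_mulEquiv (Q₁ : CombinatorialQuotient E)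
    (Q₂ : CombinatorialQuotient F) (φ : E.arith ≃ₜ* F.arith) :
    CompatibleWithCombinatorialQuotients Q₁ Q₂ φ ↔
      ∃ ψ : Q₁.com ≃* Q₂.com, ∀ x : E.arith, ψ (Q₁.proj x) = Q₂.proj (φ x) := by
  constructor
  · intro h
    change Q₁.proj.toMonoidHom.ker.map φ.toMulEquiv.toMonoidHom = Q₂.proj.toMonoidHom.ker at h
    let e₁ : E.arith ⧸ Q₁.proj.toMonoidHom.ker ≃* Q₁.com :=
      QuotientGroup.quotientKerEquivOfSurjective Q₁.proj.toMonoidHom Q₁.proj_surjective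
    let e₂ : F.arith ⧸ Q₂.proj.toMonoidHom.ker ≃* Q₂.com :=
      QuotientGroup.quotientKerEquivOfSurjective Q₂.proj.toMonoidHom Q₂.proj_surjective
    let c : E.arith ⧸ Q₁.proj.toMonoidHom.ker ≃* F.arith ⧸ Q₂.proj.toMonoidHom.ker :=
      QuotientGroup.congr _ _ φ.toMulEquiv h
    refine ⟨e₁.symm.trans (c.trans e₂), fun x => ?_⟩
    have h1 : e₁.symm (Q₁.proj x) = QuotientGroup.mk x := by
      rw [MulEquiv.symm_apply_eq]
      rfl
    rw [MulEquiv.trans_apply, MulEquiv.trans_apply, h1]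
    change e₂ (c (QuotientGroup.mk x)) = _
    rw [QuotientGroup.congr_mk]
    rfl
  · rintro ⟨ψ, hψ⟩
    change Q₁.proj.toMonoidHom.ker.map φ.toMulEquiv.toMonoidHom = Q₂.proj.toMonoidHom.ker
    ext y
    constructor
    · rintro ⟨x, hx, rfl⟩
      change Q₁.proj x = 1 at hx
      change Q₂.proj (φ x) = 1
      rw [← hψ, hx, map_one]
    · intro hy
      rw [MonoidHom.mem_ker] at hy
      change Q₂.proj y = 1 at hy
      refine ⟨φ.symm y, ?_, φ.apply_symm_apply y⟩
      change Q₁.proj (φ.symm y) = 1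
      have hx : ψ (Q₁.proj (φ.symm y)) = 1 := by rw [hψ, ContinuousMulEquiv.apply_symm_apply, hy]
      exact (map_eq_one_iff ψ ψ.injective).mp hx

/-! ### F-0227 — the universal closure of `CompatibleWithCombinatorialQuotients` is refuted -/

/-- If `Δ₁^{com} = 1` (kernel all of `Π₁`) while `Π₂ ↠ Δ₂^{com}` is injective (kernel `1`) and `Π₂ ≠ 1`, then
NO `φ : Π₁ ≅ Π₂` is compatible with the two quotients (`φ(Π₁) = Π₂ ≠ 1`).
[cite: MochizukiAbsTopI2012, Thm 2.14 (ii) p.33] -/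
theorem not_compatibleWithCombinatorialQuotients_of_ker_eq_top_of_ker_eq_bot [Nontrivial F.arith]
    {Q₁ : CombinatorialQuotient E} {Q₂ : CombinatorialQuotient F} (h₁ : Q₁.proj.toMonoidHom.ker = ⊤)
    (h₂ : Q₂.proj.toMonoidHom.ker = ⊥) (φ : E.arith ≃ₜ* F.arith) :
    ¬ CompatibleWithCombinatorialQuotients Q₁ Q₂ φ := by
  intro h
  change Q₁.proj.toMonoidHom.ker.map φ.toMulEquiv.toMonoidHom = Q₂.proj.toMonoidHom.ker at h
  rw [h₁, h₂, Subgroup.map_top_of_surjective _ φ.surjective] at h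
  exact top_ne_bot h

/-- **F-0227, universal closure REFUTED.** Over the point extension `Π = G = ℤ/2` take `Q₁ := (Π ↠ 1)`
(`Δ^{com} = 1`, the good-reduction model — abc-iut-w5-d053's `CombinatorialQuotient.exists_ker_eq_top`) and
`Q₂ := (Π ↠ Π)` (the tautological quotient, `exists_ker_eq_bot`) and `φ = id`: `id(Π) = Π ≠ 1`, so
`CompatibleWithCombinatorialQuotients Q₁ Q₂ id` fails.  Reading: a SCHEMA over abstract declared data (the
genuine `Δ^{com}` is THE quotient determined by the finite coverings of THE dual semi-graph); refuting its
universal closure is not a statement about print. [cite: MochizukiAbsTopI2012, Thm 2.14 (ii) p.33] -/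
theorem exists_not_compatibleWithCombinatorialQuotients :
    ∃ (E : FundamentalExtension.{u}) (Q₁ Q₂ : CombinatorialQuotient E),
      ¬ CompatibleWithCombinatorialQuotients Q₁ Q₂ (ContinuousMulEquiv.refl E.arith) := by
  let Z : Type u := ULift.{u} (Multiplicative (ZMod 2))
  let E : FundamentalExtension.{u} :=
    { arith := ProfiniteGrp.of Z, gal := ProfiniteGrp.of Z, aug := ContinuousMonoidHom.id Z,
      aug_surjective := Function.surjective_id }
  haveI : Nontrivial E.arith :=
    ⟨⟨ULift.up (Multiplicative.ofAdd 1), 1, fun h => absurd (congrArg ULift.down h) (by decide)⟩⟩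
  obtain ⟨Q₁, h₁⟩ := CombinatorialQuotient.exists_ker_eq_top E
  obtain ⟨Q₂, h₂⟩ := CombinatorialQuotient.exists_ker_eq_bot E
  exact ⟨E, Q₁, Q₂, not_compatibleWithCombinatorialQuotients_of_ker_eq_top_of_ker_eq_bot h₁ h₂ _⟩

/-- **F-0227 as a closed universal statement is FALSE**: it is not the case that every `φ : Π₁ ≅ Π₂` is
compatible with every pair of declared combinatorial quotients (witness:
`exists_not_compatibleWithCombinatorialQuotients`).  The row is consumable only AT NAMED INSTANCES (model
instance where it holds: `CombinatorialQuotient.exists_goodReductionModel_compatible`).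
[cite: MochizukiAbsTopI2012, Thm 2.14 (ii) p.33] -/
theorem not_forall_compatibleWithCombinatorialQuotients :
    ¬ ∀ (E F : FundamentalExtension.{u}) (Q₁ : CombinatorialQuotient E) (Q₂ : CombinatorialQuotient F)
        (φ : E.arith ≃ₜ* F.arith), CompatibleWithCombinatorialQuotients Q₁ Q₂ φ := by
  intro h
  obtain ⟨E, Q₁, Q₂, hnot⟩ := exists_not_compatibleWithCombinatorialQuotients.{u}
  exact hnot (h E E Q₁ Q₂ _)

/-- Even under the HYPOTHESIS of (ii) on both sides (trivial Galois actions on given dual-graph data) the typed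
conclusion of (ii) is not automatic for abstract quotient data: the F-0227 witness lives over an extension all of
whose dual-graph data with `Γ =` a cuspidal star have trivial action, so "(hypothesis of (ii)) → (conclusion of
(ii))" also fails as a universal closure over declared data. [cite: MochizukiAbsTopI2012, Thm 2.14 (ii) p.33] -/
theorem not_forall_trivialAction_imp_compatibleWithCombinatorialQuotients :
    ¬ ∀ (E F : FundamentalExtension.{u}) (Γ₁ : DualGraphData E) (Γ₂ : DualGraphData F)
        (Q₁ : CombinatorialQuotient E) (Q₂ : CombinatorialQuotient F) (φ : E.arith ≃ₜ* F.arith),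
        Γ₁.TrivialAction → Γ₂.TrivialAction → CompatibleWithCombinatorialQuotients Q₁ Q₂ φ := by
  intro h
  obtain ⟨E, Q₁, Q₂, hnot⟩ := exists_not_compatibleWithCombinatorialQuotients.{u}
  obtain ⟨Γ, hΓ, -⟩ := DualGraphData.exists_goodReductionModel E 0
  exact hnot (h E E Γ Γ Q₁ Q₂ _ hΓ hΓ)

/-! ### Appendix (abc-iut-f-063, same session): "functorial in `φ`" — [AbsTopI] Thm 2.14 (i) for inverses
and composites

The trunk docstring records the printed clause "functorial in `φ`" of Thm 2.14 (i) "in the docstring only".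
At the level of the typed predicates it has the following kernel content, valid for ALL data: `PreservesGeom`
is stable under `symm` / `trans` and the induced `galEquiv` is compatible with them, whence `InducesGraphIso`
along `φ` gives `InducesGraphIso` along `φ⁻¹` (inverse isomorphism of semi-graphs) and `InducesGraphIso` along
`φ`, `ψ` gives `InducesGraphIso` along `ψ ∘ φ` (composite isomorphism of semi-graphs) — together with
`inducesGraphIso_refl`, the existence form of functoriality. -/

/-- A `Δ`-preserving `φ : Π₁ ≅ Π₂` has a `Δ`-preserving inverse ([AbsAnab] Lemma 1.3.8 predicate along
`φ⁻¹`). [cite: MochizukiAbsAnab2004, Lemma 1.3.8 p.18] -/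
theorem PreservesGeom.symm {φ : E.arith ≃ₜ* F.arith} (h : PreservesGeom φ) : PreservesGeom φ.symm := by
  change E.geom.map φ.toMulEquiv.toMonoidHom = F.geom at h
  change F.geom.map φ.symm.toMulEquiv.toMonoidHom = E.geom
  rw [← h, Subgroup.map_map]
  ext x
  constructor
  · rintro ⟨y, hy, rfl⟩
    change φ.symm (φ y) ∈ _
    rwa [ContinuousMulEquiv.symm_apply_apply]
  · intro hx
    refine ⟨x, hx, ?_⟩
    change φ.symm (φ x) = x
    rw [ContinuousMulEquiv.symm_apply_apply]

/-- `Δ`-preserving isomorphisms compose ([AbsAnab] Lemma 1.3.8 predicate along `ψ ∘ φ`).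
[cite: MochizukiAbsAnab2004, Lemma 1.3.8 p.18] -/
theorem PreservesGeom.trans {φ : E.arith ≃ₜ* F.arith} {ψ : F.arith ≃ₜ* K.arith} (hφ : PreservesGeom φ)
    (hψ : PreservesGeom ψ) : PreservesGeom (φ.trans ψ) := by
  change E.geom.map φ.toMulEquiv.toMonoidHom = F.geom at hφ
  change F.geom.map ψ.toMulEquiv.toMonoidHom = K.geom at hψ
  change E.geom.map (φ.trans ψ).toMulEquiv.toMonoidHom = K.geom
  have hcomp : (φ.trans ψ).toMulEquiv.toMonoidHom =
      ψ.toMulEquiv.toMonoidHom.comp φ.toMulEquiv.toMonoidHom := MonoidHom.ext fun _ => rfl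
  rw [hcomp, ← Subgroup.map_map, hφ, hψ]

/-- The induced `galEquiv : G₁ ≅ G₂` is compatible with the augmentations: `galEquiv (aug₁ x) = aug₂ (φ x)`
(universe-polymorphic; the universe-`0` statement is `PreservesGeom.galEquiv_aug` of
`AbsAnabResidueCardProofs.lean`). [cite: MochizukiAbsAnab2004, Lemma 1.3.8 p.18] -/
theorem PreservesGeom.galEquiv_apply_aug {φ : E.arith ≃ₜ* F.arith} (h : PreservesGeom φ) (x : E.arith) :
    h.galEquiv (E.aug x) = F.aug (φ x) := by
  unfold PreservesGeom.galEquiv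
  rw [MulEquiv.trans_apply, MulEquiv.trans_apply]
  have h1 : E.quotientGeomEquivGal.symm (E.aug x) = QuotientGroup.mk x := by
    rw [MulEquiv.symm_apply_eq]
    rfl
  rw [h1]
  rfl

/-- `galEquiv` along `φ⁻¹` is the inverse of `galEquiv` along `φ`. [cite: MochizukiAbsAnab2004, Lemma 1.3.8 p.18] -/
theorem PreservesGeom.galEquiv_symm_apply {φ : E.arith ≃ₜ* F.arith} (h : PreservesGeom φ)
    (h' : PreservesGeom φ.symm) (g : F.gal) : h'.galEquiv g = h.galEquiv.symm g := by
  obtain ⟨y, rfl⟩ := F.aug_surjective g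
  rw [h'.galEquiv_apply_aug, eq_comm, MulEquiv.symm_apply_eq, h.galEquiv_apply_aug,
    ContinuousMulEquiv.apply_symm_apply]

/-- `galEquiv` along `ψ ∘ φ` is the composite of the `galEquiv`s. [cite: MochizukiAbsAnab2004, Lemma 1.3.8 p.18] -/
theorem PreservesGeom.galEquiv_trans_apply {φ : E.arith ≃ₜ* F.arith} {ψ : F.arith ≃ₜ* K.arith}
    (hφ : PreservesGeom φ) (hψ : PreservesGeom ψ) (hφψ : PreservesGeom (φ.trans ψ)) (g : E.gal) :
    hφψ.galEquiv g = hψ.galEquiv (hφ.galEquiv g) := by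
  obtain ⟨x, rfl⟩ := E.aug_surjective g
  rw [hφψ.galEquiv_apply_aug, hφ.galEquiv_apply_aug, hψ.galEquiv_apply_aug]
  rfl

/-- **(i) is compatible with inverses** ("functorial in `φ`"): if `φ` induces an isomorphism of semi-graphs
`φ_Γ : Γ₁ ≅ Γ₂` compatible with the Galois actions, then `φ⁻¹` induces `φ_Γ⁻¹ : Γ₂ ≅ Γ₁`, again compatible
(FACT-LIST F-0229, structural instance form). [cite: MochizukiAbsTopI2012, Thm 2.14 (i) p.33] -/
theorem InducesGraphIso.symm {Γ₁ : DualGraphData E} {Γ₂ : DualGraphData F} {φ : E.arith ≃ₜ* F.arith}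
    {hφ : PreservesGeom φ} (h : InducesGraphIso Γ₁ Γ₂ φ hφ) (hφ' : PreservesGeom φ.symm) :
    InducesGraphIso Γ₂ Γ₁ φ.symm hφ' := by
  obtain ⟨f, hf⟩ := h
  refine ⟨f.symm, fun g' => ?_⟩
  rw [hφ.galEquiv_symm_apply hφ' g']
  have key := hf (hφ.galEquiv.symm g')
  rw [MulEquiv.apply_symm_apply] at key
  change (Γ₂.galAction g').hom ≫ f.inv = f.inv ≫ (Γ₁.galAction (hφ.galEquiv.symm g')).hom
  rw [Iso.eq_inv_comp, ← Category.assoc, Iso.comp_inv_eq]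
  exact key.symm

/-- **(i) is compatible with composition** ("functorial in `φ`"): isomorphisms of semi-graphs induced along
`φ : Π₁ ≅ Π₂` and `ψ : Π₂ ≅ Π₃`, compatible with the Galois actions, compose to one induced along `ψ ∘ φ`
(FACT-LIST F-0229, structural instance form). [cite: MochizukiAbsTopI2012, Thm 2.14 (i) p.33] -/
theorem InducesGraphIso.trans {Γ₁ : DualGraphData E} {Γ₂ : DualGraphData F} {Γ₃ : DualGraphData K}
    {φ : E.arith ≃ₜ* F.arith} {ψ : F.arith ≃ₜ* K.arith} {hφ : PreservesGeom φ} {hψ : PreservesGeom ψ}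
    (h₁₂ : InducesGraphIso Γ₁ Γ₂ φ hφ) (h₂₃ : InducesGraphIso Γ₂ Γ₃ ψ hψ)
    (hφψ : PreservesGeom (φ.trans ψ)) : InducesGraphIso Γ₁ Γ₃ (φ.trans ψ) hφψ := by
  obtain ⟨f, hf⟩ := h₁₂
  obtain ⟨f', hf'⟩ := h₂₃
  refine ⟨f ≪≫ f', fun g => ?_⟩
  rw [hφ.galEquiv_trans_apply hψ hφψ g]
  simp only [Iso.trans_hom, Category.assoc]
  rw [reassoc_of% (hf g), hf' (hφ.galEquiv g)]

/-- Hence, for fixed dual-graph data on both sides, the set of `Δ`-preserving `φ` satisfying (i) contains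
`id` and is closed under inverses and composites — e.g. (i) along `φ` and along `φ⁻¹` gives (i) along
`φ⁻¹ ∘ φ`-shaped round trips on `Γ₁`. [cite: MochizukiAbsTopI2012, Thm 2.14 (i) p.33] -/
theorem InducesGraphIso.self_of_roundTrip {Γ₁ : DualGraphData E} {Γ₂ : DualGraphData F}
    {φ : E.arith ≃ₜ* F.arith} {hφ : PreservesGeom φ} (h : InducesGraphIso Γ₁ Γ₂ φ hφ)
    (hφ' : PreservesGeom φ.symm) (hround : PreservesGeom (φ.trans φ.symm)) :
    InducesGraphIso Γ₁ Γ₁ (φ.trans φ.symm) hround :=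
  h.trans (h.symm hφ') hround

end FundamentalExtension

end Literature.AnabelianGeometry.AbsoluteAnabelian
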